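import Mathlib
import Summits.KontsevichZagierPeriods.Zeta5Search.DenomLaw.ShiftedL5Kit
import Summits.KontsevichZagierPeriods.Zeta5Search.LawA4Proof
import HarnessLib

/-!
# ζ(5) search — a COVER KIT for THEOREM A⁗ (`SecondOrder.lawA4_holds`, `7 − 2M`): the five class clauses from a class-type cover — DENOM-LAW prover-d1 gen 18

HONEST FRAMING: systematic search; no irrationality claim unless certified.  Cell `pub-zeta5`, track «DENOM-LAW», seat `denom-prover-d1`
gen 18 (`HOME/denom-law/prover-d1/ATTEMPT-18.md` §2).  `p`-adic valuation bookkeeping for the explicit rationals `Cas_j(b)`; nothing about ζ(5);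
no model exponent moves; records in print UNMOVED.

The tree consumes THEOREM A⁗ (`ThirdOrderDigit.LawA4`, PROVED `SecondOrder.lawA4_holds`; value `7 − 2M`) either per instance (`decide` on `LawA4ClassesD`)
or through gen 3's L5 kit `DenomLaw.clausesL5_of_cover`, whose check `checkL5` also demands the SHAPE clause (degree-3 T-shapes at `ν = −M + 3`) that A⁗
does not need.  On the general-`b` profile `N_p = 17` (branch `(1,5)`) the five A⁗ clauses hold in the frame `(8, [1,−5,−5,1])` while the shape clause
FAILS (classes `[1,−1,−6,1]` at `−5`), so this file supplies the A⁗-only tool: a type-level Boolean check of the five clauses of `RecordWindowsA4.LawA4Classes`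
(SPELLED OUT as a `List.all` in the hypotheses — exactly the first five conjuncts of `checkL5`; no new definition), the transfer `lawA4Classes_of_cover`, and
the any-`j` wrappers `lawA4_of_cover` / `cover_A4` (`RecordWindowsA4.lawA4_apply lawA4_holds`; `M ≥ 6` even, `T` a palindrome, window prime).  Valuations of
explicit rationals; every model exponent these feed is `< 1`.
-/

open Finset

namespace Summit.KontsevichZagierPeriods.Zeta5Search.DenomLaw

open Summit.KontsevichZagierPeriods.Zeta5Search.ClusterValuation
open Summit.KontsevichZagierPeriods.Zeta5Search.CasoratianValuation (InPolytope shift casoratian)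
open Summit.KontsevichZagierPeriods.Zeta5Search.WedgeDictionary (dOf)
open Summit.KontsevichZagierPeriods.Zeta5Search.ClassTypeCover
open Summit.KontsevichZagierPeriods.Zeta5Search.SecondOrder (classTypeList isRaise isRaise2 lawA4_holds)
open Summit.KontsevichZagierPeriods.Zeta5Search.RecordWindowsA4 (LawA4Classes lawA4_apply)

variable {p : ℕ}

/-- **The five A⁗ clauses of `b` from a cover**: if every residue is a typed level class of a type in `TY` and, on the list (spelled-out `List.all`, the first
five conjuncts of `DenomLaw.checkL5`; no new definition), every multipole type has `E ≥ −M`, singles `ν ≥ −M+1`, multipole types of exponent `−M` are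
centre-free with list `T`, pole types with `ν = −M+1` are single raises of `T` or the odd-centre type `T`, pole types with `ν = −M+2` are admissible double
raises of `T` — then `LawA4Classes b p M T`. -/
theorem lawA4Classes_of_cover [Fact p.Prime] {b : ℕ → ℤ} {TY : List (List ℤ × Bool)} (hcov : Cover b p TY) {M : ℕ} {T : List ℤ}
    (hchk : ((TY.all fun tc =>
      (decide (polesL tc.1 < 2) || decide (-(M : ℤ) ≤ expL (decide (¬ (2 : ℤ) ∣ b 0)) tc.1 tc.2)) &&
      (!decide (polesL tc.1 = 1) || decide (-(M : ℤ) + 1 ≤ nuL (decide (¬ (2 : ℤ) ∣ b 0)) tc.1 tc.2)) &&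
      (!(decide (2 ≤ polesL tc.1) && decide (expL (decide (¬ (2 : ℤ) ∣ b 0)) tc.1 tc.2 = -(M : ℤ))) || (!tc.2 && decide (tc.1 = T))) &&
      (!(decide (1 ≤ polesL tc.1) && decide (nuL (decide (¬ (2 : ℤ) ∣ b 0)) tc.1 tc.2 = -(M : ℤ) + 1)) ||
        (isRaise T tc.1 || (decide (¬ (2 : ℤ) ∣ b 0) && tc.2 && decide (tc.1 = T)))) &&
      (!(decide (1 ≤ polesL tc.1) && decide (nuL (decide (¬ (2 : ℤ) ∣ b 0)) tc.1 tc.2 = -(M : ℤ) + 2)) || isRaise2 T tc.1)) = true)) : LawA4Classes b p M T := by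
  rw [List.all_eq_true] at hchk
  refine ⟨?_, ?_, ?_, ?_, ?_⟩
  · intro x hxm
    obtain ⟨hx, h2⟩ := (mem_multipoleClasses_iff b p x).1 hxm
    obtain ⟨tc, htc, ht⟩ := hcov x hx
    have hc := hchk tc htc
    simp only [Bool.and_eq_true, Bool.or_eq_true, decide_eq_true_eq] at hc
    rw [ht.classPoleCount_eq] at h2
    rw [ht.classExp_eq]
    rcases hc.1.1.1.1 with h | h
    · omega
    · exact h
  · intro y hy h1
    obtain ⟨tc, htc, ht⟩ := hcov y hy
    have hc := hchk tc htc
    simp only [Bool.and_eq_true, Bool.or_eq_true, Bool.not_eq_true', decide_eq_false_iff_not, decide_eq_true_eq] at hc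
    rw [ht.classPoleCount_eq] at h1
    rw [ht.classNu_eq]
    rcases hc.1.1.1.2 with h | h
    · exact absurd h1 h
    · exact h
  · intro x hxm hE
    obtain ⟨hx, h2⟩ := (mem_multipoleClasses_iff b p x).1 hxm
    obtain ⟨tc, htc, ht⟩ := hcov x hx
    have hc := hchk tc htc
    simp only [Bool.and_eq_true, Bool.or_eq_true, Bool.not_eq_true', Bool.and_eq_false_iff, decide_eq_false_iff_not,
      decide_eq_true_eq] at hc
    rw [ht.classPoleCount_eq] at h2
    rw [ht.classExp_eq] at hE
    rcases hc.1.1.2 with (h | h) | ⟨hc1, hc2⟩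
    · omega
    · exact absurd hE h
    · refine ⟨fun hcen => ?_, by rw [ht.classTypeList_eq]; exact hc2⟩
      rw [ht.cen_iff.1 hcen] at hc1
      exact Bool.noConfusion hc1
  · intro y hy h1 hnu
    obtain ⟨tc, htc, ht⟩ := hcov y hy
    have hc := hchk tc htc
    simp only [Bool.and_eq_true, Bool.or_eq_true, Bool.not_eq_true', Bool.and_eq_false_iff, decide_eq_false_iff_not,
      decide_eq_true_eq] at hc
    rw [ht.classPoleCount_eq] at h1
    rw [ht.classNu_eq] at hnu
    rcases hc.1.2 with (h | h) | (h | ⟨⟨ho, hc1⟩, hc2⟩)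
    · omega
    · exact absurd hnu h
    · left; rw [ht.classTypeList_eq]; exact h
    · right
      exact ⟨ho, ht.cen_iff.2 hc1, by rw [ht.classTypeList_eq]; exact hc2⟩
  · intro z hz h1 hnu
    obtain ⟨tc, htc, ht⟩ := hcov z hz
    have hc := hchk tc htc
    simp only [Bool.and_eq_true, Bool.or_eq_true, Bool.not_eq_true', Bool.and_eq_false_iff, decide_eq_false_iff_not,
      decide_eq_true_eq] at hc
    rw [ht.classPoleCount_eq] at h1
    rw [ht.classNu_eq] at hnu
    rcases hc.2 with (h | h) | h
    · omega
    · exact absurd hnu h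
    · rw [ht.classTypeList_eq]; exact h

/-- **THEOREM A⁗ from a cover of `b` alone**: `7 − 2M ≤ v_p(Cas_j(b))` (`M ≥ 6` even, `T` a palindrome, `5 ≤ p ≤ b₀ < p² − 2`). -/
theorem lawA4_of_cover {b : ℕ → ℤ} {j : ℕ} (hb : InPolytope b) (hb' : InPolytope (shift b j)) (hj1 : 1 ≤ j) (hj7 : j ≤ 7)
    (hpr : p.Prime) (hp5 : 5 ≤ p) (hpb : (p : ℤ) ≤ b 0) (hwin : (b 0 + 2 : ℤ) < (p : ℤ) ^ 2)
    {TY : List (List ℤ × Bool)} (hcov : Cover b p TY) {M : ℕ} (hM : 6 ≤ M) (hMe : Even M) {T : List ℤ} (hT : T.reverse = T)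
    (hchk : ((TY.all fun tc =>
      (decide (polesL tc.1 < 2) || decide (-(M : ℤ) ≤ expL (decide (¬ (2 : ℤ) ∣ b 0)) tc.1 tc.2)) &&
      (!decide (polesL tc.1 = 1) || decide (-(M : ℤ) + 1 ≤ nuL (decide (¬ (2 : ℤ) ∣ b 0)) tc.1 tc.2)) &&
      (!(decide (2 ≤ polesL tc.1) && decide (expL (decide (¬ (2 : ℤ) ∣ b 0)) tc.1 tc.2 = -(M : ℤ))) || (!tc.2 && decide (tc.1 = T))) &&
      (!(decide (1 ≤ polesL tc.1) && decide (nuL (decide (¬ (2 : ℤ) ∣ b 0)) tc.1 tc.2 = -(M : ℤ) + 1)) ||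
        (isRaise T tc.1 || (decide (¬ (2 : ℤ) ∣ b 0) && tc.2 && decide (tc.1 = T)))) &&
      (!(decide (1 ≤ polesL tc.1) && decide (nuL (decide (¬ (2 : ℤ) ∣ b 0)) tc.1 tc.2 = -(M : ℤ) + 2)) || isRaise2 T tc.1)) = true)) (hcas : casoratian b j ≠ 0) :
    (7 : ℤ) - 2 * M ≤ padicValRat p (casoratian b j) := by
  haveI : Fact p.Prime := ⟨hpr⟩
  exact lawA4_apply lawA4_holds b p j M T hb hb' hj1 hj7 hpr hp5 hpb hwin hM hMe hT (lawA4Classes_of_cover hcov hchk) hcas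

/-- **WINDOW BOUND by THEOREM A⁗ from a cover**: `c ≤ v_p(Cas_j(b))` whenever `c ≤ 7 − 2M`. -/
theorem cover_A4 {b : ℕ → ℤ} {j : ℕ} (hb : InPolytope b) (hb' : InPolytope (shift b j)) (hj1 : 1 ≤ j) (hj7 : j ≤ 7)
    (hpr : p.Prime) (hp5 : 5 ≤ p) (hpb : (p : ℤ) ≤ b 0) (hwin : (b 0 + 2 : ℤ) < (p : ℤ) ^ 2)
    {TY : List (List ℤ × Bool)} (hcov : Cover b p TY) {M : ℕ} (hM : 6 ≤ M) (hMe : Even M) {T : List ℤ} (hT : T.reverse = T)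
    (hchk : ((TY.all fun tc =>
      (decide (polesL tc.1 < 2) || decide (-(M : ℤ) ≤ expL (decide (¬ (2 : ℤ) ∣ b 0)) tc.1 tc.2)) &&
      (!decide (polesL tc.1 = 1) || decide (-(M : ℤ) + 1 ≤ nuL (decide (¬ (2 : ℤ) ∣ b 0)) tc.1 tc.2)) &&
      (!(decide (2 ≤ polesL tc.1) && decide (expL (decide (¬ (2 : ℤ) ∣ b 0)) tc.1 tc.2 = -(M : ℤ))) || (!tc.2 && decide (tc.1 = T))) &&
      (!(decide (1 ≤ polesL tc.1) && decide (nuL (decide (¬ (2 : ℤ) ∣ b 0)) tc.1 tc.2 = -(M : ℤ) + 1)) ||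
        (isRaise T tc.1 || (decide (¬ (2 : ℤ) ∣ b 0) && tc.2 && decide (tc.1 = T)))) &&
      (!(decide (1 ≤ polesL tc.1) && decide (nuL (decide (¬ (2 : ℤ) ∣ b 0)) tc.1 tc.2 = -(M : ℤ) + 2)) || isRaise2 T tc.1)) = true)) {c : ℤ} (hc : c ≤ 7 - 2 * (M : ℤ)) (hcas : casoratian b j ≠ 0) :
    c ≤ padicValRat p (casoratian b j) :=
  le_trans hc (lawA4_of_cover hb hb' hj1 hj7 hpr hp5 hpb hwin hcov hM hMe hT hchk hcas)

/-- Sanity of the spelled-out check: the `N_p = 17` (branch `(1,5)`) deep inventory passes the five clauses at `(8, [1,−5,−5,1])` (`b₀` even), although the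
shape clause of `checkL5` fails there (`[1,−1,−6,1]` at `ν = −5` is not a degree-3 T-shape). -/
example : (([([1, -5, -5, 1], false), ([1, -4, -5, 1], false), ([1, -5, -4, 1], false), ([1, -3, -5, 1], false), ([1, -4, -4, 1], false),
    ([1, -1, -6, 1], false), ([1, -6, 1], false)] : List (List ℤ × Bool)).all fun tc =>
      (decide (polesL tc.1 < 2) || decide (-((8 : ℕ) : ℤ) ≤ expL false tc.1 tc.2)) &&
      (!decide (polesL tc.1 = 1) || decide (-((8 : ℕ) : ℤ) + 1 ≤ nuL false tc.1 tc.2)) &&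
      (!(decide (2 ≤ polesL tc.1) && decide (expL false tc.1 tc.2 = -((8 : ℕ) : ℤ))) || (!tc.2 && decide (tc.1 = [1, -5, -5, 1]))) &&
      (!(decide (1 ≤ polesL tc.1) && decide (nuL false tc.1 tc.2 = -((8 : ℕ) : ℤ) + 1)) ||
        (isRaise [1, -5, -5, 1] tc.1 || (false && tc.2 && decide (tc.1 = [1, -5, -5, 1])))) &&
      (!(decide (1 ≤ polesL tc.1) && decide (nuL false tc.1 tc.2 = -((8 : ℕ) : ℤ) + 2)) || isRaise2 [1, -5, -5, 1] tc.1)) = true ∧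
    checkL5 false [([1, -5, -5, 1], false), ([1, -1, -6, 1], false)] 8 [1, -5, -5, 1] = false := by decide

end Summit.KontsevichZagierPeriods.Zeta5Search.DenomLaw
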